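import Literature.MathematicalPhysics.QuantumFieldTheory.Balaban1983to89.B9Eq342GreenPrimeTowerGradientRowClosed
import Literature.MathematicalPhysics.QuantumFieldTheory.Balaban1983to89.B9Eq342MajorantReadingSeam
import Literature.MathematicalPhysics.QuantumFieldTheory.Balaban1983to89.B9Eq341TowerBlockGeometry
import Literature.MathematicalPhysics.QuantumFieldTheory.Balaban1983to89.B9Eq349BlockMultipliers
import Literature.MathematicalPhysics.QuantumFieldTheory.Balaban1983to89.B9Eq323SiteLaplacianJunction

/-!
# `Balaban1983to89.B9Eq342TowerGradientRowMajorant` — T. Bałaban, *Propagators for lattice gauge theories in a background field*, Commun. Math. Phys. **99** (1985)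
# 389–434 [Balaban1985BackgroundPropagators] Thm 3.1 (3.42)₂ p. 397 («|(∇_UG′)(b, x′)| ≦ B₀Lʲη…e^{−δ₀d(y,y′)}») with (3.3) p. 390, (3.8) p. 392 and [Balaban1984PropagatorsII] (2.51)
# p. 232: **THE SECOND THEOREM-3.1 INPUT OF THE SECT. B PROGRAMME AT THE NE9 CHAIN's `k`-LEVEL SITE PROPAGATOR — `h342_2` of
# `B9Thm34SectBUniform(R1).thm34_Gp_uniform` (`conj b (∇_k) · conj b (readA φ G′_k(U)) ≺ B_G·len·e^{−δ₀d}` for every difference letter `∇_k`, `k ∈ κ ⊕ κ`) over `towerGeom`,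
# constants BEFORE the height, ON PRINT's CLASS** — the OWNER's closed covariant-gradient row `B9Eq342GreenPrimeTowerGradientRowClosed.exists_gradRow_GpOfUk` read in `𝔸`
# (the forward letter `η⁻¹D_μ` directly, the backward letter `−η⁻¹D*_μ` by `D*_μG(x) = −R(U_μ(x−e_μ))⁻¹(D_μG)(x−e_μ)`) and realified by the generic seam; junction item (j4)₂
# of the NE9 lineage's route memo `ROUTE-J-VIA-THM34-g98.md`

statement-level skeleton of published theorems with citation tags; proofs where landed; nothing here is a claim about the Yang–Mills mass gap

CITATION HEADER (lean-in-tree rule).  Audit cell `pub-balaban`, sub-cell `t4`, BINDER row NE9; NE9 crux-team LEAF PROVER 01 (`b2b-balaban-t4-ne9-formalise-leaf-01`,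
gen 99; bears_on: R4/N22).  Vocabulary BY NAME: the OWNER's `B9Eq342GreenPrimeTowerGradientRowClosed.exists_gradRow_GpOfUk` (t4-ne9-p1; the cell's road to (3.42)₂ on its MODEL),
`B9Eq349BlockMultipliers.exists_block_clm_family`, g98's `B9Eq323SiteLaplacianJunction.phi_covDerivL2K` (the chain's `D^η_U` read in `𝔸` = r06's `η⁻¹covD`), r06's
`B9Eq352GradLetters.diffLetter` (+ `diffLetter_inl`∕`_inr`, `B9Eq352DivFormLetters.gradLetterF_apply`∕`gradLetterB_apply`), `B9Eq39Adjoint.R`∕`covD`∕`covDstar`, this lineage's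
`B9Eq342MajorantReadingSeam.hasMajorant_conj_of_blockRow`, `B9Eq341TowerBlockGeometry`, `B9Eq357QprimeTowerKernelForm.blkK`, `B9Eq324PenaltyKernelForm.readA`.  Sources read through those
files' verbatim quotations: [Balaban1985BackgroundPropagators] p. 397 Thm 3.1 (3.42), p. 390 (3.3), p. 392 (3.8); [Balaban1984PropagatorsII] p. 232 (2.51).  [folklore] COMPOSITION BY NAME;
NOTHING of print's proofs is reproduced.

WHAT IS PROVED (sorry-free; proof lane — no `def`).
* §1 `gradLetterF_mul_readA_apply`, `gradLetterB_mul_readA_apply` (the difference letters after `readA`), `covDstar_eq_neg_R_covD` (`D*_μG(x) = −R(U_μ(x′))⁻¹(D_μG)(x′)`, `x′ = x − e_μ`),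
  `norm_R_le_of_norm_le_one` (`‖R(u)X‖ ≤ ‖X‖` for `‖u‖, ‖u⁻¹‖ ≤ 1`), `tdist_blkK_shift_le_one` (one fine step moves the big-block coordinate by `≤ 1` in the sup distance).
* §2 **`exists_hasMajorant_diffLetter_GpOfUk`** — `∃ α₂ B_G δ₀ > 0` BEFORE the height such that, at every height `n` on print's diagonal, every period `m`, every background of the
  chain's class WITH the bond-gradient datum `‖U(x,μ) − U(x−e_μ,μ)‖ ≤ αη²` (`α ≤ α₂`), ANY `hpos′`, ANY `M, R_r, H`, and EVERY `k : Fin d ⊕ Fin d`: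
  `HasMajorant (toB6 (towerGeom …) R_r H) (fun p => blkK p.1) (conj b (diffLetter T U_d η⁻¹ k) * conj b (readA φ (G′_k(U)))) (fun a a′ => B_G·len(a)·e^{−δ₀·d(a,a′)})` — LITERALLY
  `h342_2` of `thm34_Gp_uniform` (dictionary `T μ := shiftEquiv μ`, `U_d μ y := U(y, μ)`; `len = 1` on the diagonal; `δ₀ := κ′∕d`).
HONEST SCOPE.  Composition of the owner's closed row (cell constants, NOT print's `B₀(d, L)`; `2 ≤ L`, `1 ≤ d`), the φ-reading, the backward-difference identity and the seam; the
adjoint-side input `h342_3` (`G′∇*`) is NOT here (next file); the row is the cell's MODEL of (3.42)₂ («NE9 ⇐ the named binders»; O-NE9-1, #5 UNRULED); NE9 NOT PRINTED ∕ NOT PROVED;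
spine PROVED 0∕9; rung (B)+1 finite T⁴ — NOT infinite volume, NOT mass gap, NOT BetaPertH, NOT Clay.  HONEST DEPENDENCY: continuum YM on T⁴ ⇐ BetaPertH ∧ nine spine estimates (0/9
proved); BetaPertH ⇐ (D1) ∧ (D4) ∧ CAP+tail; G-an2-4 gates asym, D1 and NE2/3/4.  NEW file; nothing modified.  Net new unproved facts: 0.
-/

noncomputable section

open scoped BigOperators InnerProductSpace

namespace Literature.MathematicalPhysics.QuantumFieldTheory.Balaban1983to89.B9Eq342TowerGradientRowMajorant

open B4Sect5Torus (TSite tdist tdist_triangle tdist_symm)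
open B4Sect5Proof (latticeConst latticeConst_nonneg)
open B7Prop1Explicit (U1)
open B9SectCLatticeCarrier (Bond btgt shift unshift shift_unshift)
open B9Eq311L2Pairing (WL2)
open B11Eq103H1Complex (SiteL2K covDerivL2K)
open B9Eq310HessianOperator (adTransportW)
open B9Eq319QprimeTorus (blockCoord)
open B9Eq315QTower (towerP UlevOf)
open B9Eq316TowerFlatIsOneStep (towerP_eq_fineP_pow siteCast)
open B9Eq324DeltaPrimeATower (laplacePrimeAk GpOfUk)
open B9Eq342GreenPrimeTowerGradientRowClosed (exists_gradRow_GpOfUk)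
open B9Eq349BlockMultipliers (exists_block_clm_family)
open B6RandomWalk (HasMajorant hasMajorant_mono)
open B9Thm34Ext (toB6)
open B9Eq39Adjoint (R R_smul covD covDstar)
open B9Eq33CovDerivVector (shiftEquiv)
open B9Eq352DivFormLetters (conj gradLetterF gradLetterB gradLetterF_apply gradLetterB_apply)
open B9Eq352GradLetters (diffLetter diffLetter_inl diffLetter_inr)
open B9Eq324PenaltyKernelForm (readA readA_apply)
open B9Eq357QprimeTowerKernelForm (blkK)
open B9Eq341TowerBlockGeometry (towerGeom len_towerGeom dist_towerGeom tdist1_le_card_mul_tdist blkK_eq_blockCoord_siteCast siteCast_shift)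
open B9Eq342MajorantReadingSeam (hasMajorant_conj_of_blockRow)
open B9Eq323SiteLaplacianJunction (phi_covDerivL2K)
open B9Eq349LaplacePrimeBlockLetters (tdist_blockCoord_shift_le_one)

/-! ## §1 The difference letters after `readA`; the backward difference through the forward one -/

section Letters

variable {d : ℕ} {P : Fin d → ℕ} {𝔸 : Type*} [NormedRing 𝔸] [NormedAlgebra ℂ 𝔸] {W : Type*} [NormedAddCommGroup W] [InnerProductSpace ℂ W]
  (φ : W ≃ₗ[ℂ] 𝔸) {c₀ : ℝ} (U : Bond d P → 𝔸ˣ) (c : ℂ) (μ : Fin d)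

/-- `(η⁻¹D_μ ∘ readA G) g x = η⁻¹·covD_μ (readA G g) x`. [cite: Balaban1985BackgroundPropagators, (3.3) p.390] -/
theorem gradLetterF_mul_readA_apply (G : SiteL2K ℂ d P c₀ W →ₗ[ℂ] SiteL2K ℂ d P c₀ W) (g : TSite d P → 𝔸) (x : TSite d P) :
    (gradLetterF (fun μ => shiftEquiv (Pd := P) μ) (fun μ y => U (y, μ)) c μ * readA φ G) g x =
      c • covD (fun μ => shiftEquiv (Pd := P) μ) (fun μ y => U (y, μ)) μ (readA φ G g) x := by
  rw [Module.End.mul_apply, gradLetterF_apply]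

/-- `(η⁻¹D*_μ ∘ readA G) g x = η⁻¹·covDstar_μ (readA G g) x`. [cite: Balaban1985BackgroundPropagators, (3.8) p.392] -/
theorem gradLetterB_mul_readA_apply (G : SiteL2K ℂ d P c₀ W →ₗ[ℂ] SiteL2K ℂ d P c₀ W) (g : TSite d P → 𝔸) (x : TSite d P) :
    (gradLetterB (fun μ => shiftEquiv (Pd := P) μ) (fun μ y => U (y, μ)) c μ * readA φ G) g x =
      c • covDstar (fun μ => shiftEquiv (Pd := P) μ) (fun μ y => U (y, μ)) μ (readA φ G g) x := by
  rw [Module.End.mul_apply, gradLetterB_apply]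

omit [NormedAlgebra ℂ 𝔸] in
/-- **`D*_μG(x) = −R(U_μ(x′))⁻¹·(D_μG)(x′)`, `x′ = T_μ⁻¹x`** — the backward covariant difference is the transported forward one at the preceding site.
[cite: Balaban1985BackgroundPropagators, (3.3) p.390, (3.8) p.392] -/
theorem covDstar_eq_neg_R_covD [Algebra ℂ 𝔸] {S ι : Type*} (T : ι → Equiv.Perm S) (V : ι → S → 𝔸ˣ) (ν : ι) (G : S → 𝔸) (x : S) :
    covDstar T V ν G x = -R (V ν ((T ν).symm x))⁻¹ (covD T V ν G ((T ν).symm x)) := by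
  simp only [covDstar, covD, Equiv.apply_symm_apply, B9Eq39Adjoint.R_sub, B9Eq39Adjoint.R_inv_R, neg_sub]

omit [NormedAlgebra ℂ 𝔸] in
/-- `‖R(u)X‖ ≤ ‖X‖` for `‖u‖, ‖u⁻¹‖ ≤ 1`. [cite: Balaban1985BackgroundPropagators, (3.5) p.391] -/
theorem norm_R_le_of_norm_le_one (u : 𝔸ˣ) (hu : ‖(u : 𝔸)‖ ≤ 1 ∧ ‖((u⁻¹ : 𝔸ˣ) : 𝔸)‖ ≤ 1) (X : 𝔸) : ‖R u X‖ ≤ ‖X‖ := by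
  unfold R
  calc ‖(u : 𝔸) * X * ((u⁻¹ : 𝔸ˣ) : 𝔸)‖ ≤ ‖(u : 𝔸)‖ * ‖X‖ * ‖((u⁻¹ : 𝔸ˣ) : 𝔸)‖ :=
        (norm_mul_le _ _).trans (mul_le_mul_of_nonneg_right (norm_mul_le _ _) (norm_nonneg _))
    _ ≤ 1 * ‖X‖ * 1 := by gcongr <;> [exact hu.1; exact hu.2]
    _ = ‖X‖ := by rw [one_mul, mul_one]

end Letters

section Blocks

variable {d : ℕ} (L : ℕ) [NeZero L] (m : Fin d → ℕ) [∀ i, NeZero (m i)] (n : ℕ)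

/-- **one fine step moves the big-block coordinate by at most one coarse unit** (sup distance; `tdist_blockCoord_shift_le_one` at block size `L^{n+1}`).
[cite: Balaban1985Averaging, (2) p.17; Balaban1985BackgroundPropagators, (3.49) p.399] -/
theorem tdist_blkK_shift_le_one (μ : Fin d) (x : TSite d (towerP L m (n + 1))) : tdist m (blkK L m n x) (blkK L m n (shift μ x)) ≤ 1 := by
  have hm : ∀ i, 1 ≤ m i := fun i => Nat.one_le_iff_ne_zero.mpr (NeZero.ne (m i))
  rw [blkK_eq_blockCoord_siteCast, blkK_eq_blockCoord_siteCast, siteCast_shift]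
  exact tdist_blockCoord_shift_le_one (L := L ^ (n + 1)) hm _ μ

end Blocks

/-! ## §2 `h342_2` at the chain's `G′_k(U)` -/

section Main

variable {d : ℕ} (L : ℕ) [NeZero L] {𝔸 : Type*} [NormedRing 𝔸] [NormedAlgebra ℂ 𝔸] [CompleteSpace 𝔸] [NormOneClass 𝔸] [StarRing 𝔸]
  {W : Type*} [NormedAddCommGroup W] [InnerProductSpace ℂ W] [FiniteDimensional ℂ W] (φ : W ≃ₗ[ℂ] 𝔸) {a' Mφ Mφ' : ℝ}
  (hMφ : 0 ≤ Mφ) (hMφ' : 0 ≤ Mφ') (hφn : ∀ w, ‖φ w‖ ≤ Mφ * ‖w‖) (hφn' : ∀ X, ‖φ.symm X‖ ≤ Mφ' * ‖X‖) (ha' : 0 < a')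
  {r : ℝ} (hr0 : 0 ≤ r) (hr1 : r < 1)
  (τ : 𝔸 →ₗ[ℂ] ℂ) (hτ₂ : ∀ X Y : 𝔸, τ (X * Y) = τ (Y * X)) (hφτ : ∀ X Y : 𝔸, ⟪φ.symm X, φ.symm Y⟫_ℂ = τ (star X * Y))
  {ι : Type} [Fintype ι] (b : Module.Basis ι ℝ 𝔸) {M₂ : ℝ} (hM₂ : 0 ≤ M₂) (hrepr : ∀ (v : 𝔸) (i : ι), |b.repr v i| ≤ M₂ * ‖v‖)

include hMφ hMφ' hφn hφn' ha' hr0 hr1 hτ₂ hφτ hM₂ hrepr in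
/-- **`h342_2` OF `thm34_Gp_uniform` AT THE CHAIN's `G′_k(U)`, CONSTANTS BEFORE THE HEIGHT, ON PRINT's CLASS** — see the module docstring.
[cite: Balaban1985BackgroundPropagators, Thm 3.1 (3.42) p.397, (3.3) p.390, (3.8) p.392; Balaban1984PropagatorsII, (2.51) p.232] -/
theorem exists_hasMajorant_diffLetter_GpOfUk (hd : 1 ≤ d) (hL2 : 2 ≤ L) :
    ∃ α₂ BG δ₀ : ℝ, 0 < α₂ ∧ 0 < BG ∧ 0 < δ₀ ∧
      ∀ (n : ℕ) (η : ℝ), η * (L : ℝ) ^ (n + 1) = 1 →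
      ∀ (c₀ c₁ : ℝ) [Fact (0 < c₀)] [Fact (0 < c₁)], c₀ * ((L : ℝ) ^ (n + 1)) ^ d = c₁ →
      ∀ (m : Fin d → ℕ) [∀ i, NeZero (m i)] (U : Bond d (towerP L m (n + 1)) → 𝔸ˣ),
        (∀ (bd : Bond d (towerP L m (n + 1))) (v u : W), ⟪adTransportW φ U bd v, u⟫_ℂ = ⟪v, adTransportW φ (fun bd => (U bd)⁻¹) bd u⟫_ℂ) →
      ∀ (α : ℝ), 0 ≤ α → α ≤ α₂ → (∀ bd, U bd ∈ U1 𝔸) → (∀ bd, ‖(U bd : 𝔸) - 1‖ ≤ α * η) →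
        (∀ (x : TSite d (towerP L m (n + 1))) (μ : Fin d), ‖(U (x, μ) : 𝔸) - (U (unshift μ x, μ) : 𝔸)‖ ≤ α * η ^ 2) →
      ∀ (εU : ℕ → ℝ), (∀ j, 0 ≤ εU j) → (∀ j < n + 1, εU j ≤ α * r ^ j) →
        (∀ (j : ℕ) (bd : Bond d (towerP L m (j + 1))), ‖(UlevOf L m (n + 1) U j bd : 𝔸) - 1‖ ≤ εU j) →
        (∀ (j : ℕ) (bd : Bond d (towerP L m (j + 1))), UlevOf L m (n + 1) U j bd ∈ U1 𝔸) →
        (∀ bd, star (U bd : 𝔸) = ((U bd)⁻¹ : 𝔸ˣ)) →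
        (∀ (j : ℕ) (bd : Bond d (towerP L m (j + 1))) (w : W), ‖adTransportW φ (UlevOf L m (n + 1) U j) bd w‖ ≤ ‖w‖) →
      ∀ (hpos' : ∀ x : SiteL2K ℂ d (towerP L m (n + 1)) c₀ W, x ≠ 0 → 0 < RCLike.re ⟪x, laplacePrimeAk L m n φ η U a' (c₁ := c₁) x⟫_ℂ)
        (M Rr : ℝ) (H : Prop) (k : Fin d ⊕ Fin d),
      HasMajorant (g := toB6 (towerGeom L m n η M) Rr H) (fun p : TSite d (towerP L m (n + 1)) × ι => blkK L m n p.1)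
        (conj b (diffLetter (fun μ => shiftEquiv (Pd := towerP L m (n + 1)) μ) (fun μ y => U (y, μ)) ((η : ℂ))⁻¹ k) *
          conj b (readA φ (GpOfUk L m n φ η U a' (c₁ := c₁) hpos')))
        (fun a a' => BG * (towerGeom L m n η M).len a * Real.exp (-(δ₀ * (towerGeom L m n η M).dist a a'))) := by
  obtain ⟨α₂, B, κ', hα₂, hB, hκ', hrow⟩ := exists_gradRow_GpOfUk L φ (a' := a') hMφ hMφ' hφn hφn' ha' hr0 hr1 τ hτ₂ hφτ hd hL2
  have hSb : 0 ≤ ∑ i, ‖b i‖ := Finset.sum_nonneg fun i _ => norm_nonneg _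
  have hd0 : (0 : ℝ) < d := by exact_mod_cast hd
  refine ⟨α₂, M₂ * (∑ i, ‖b i‖) * (Mφ * Mφ' * B * Real.exp κ') + 1, κ' / d, hα₂, by positivity, div_pos hκ' hd0, ?_⟩
  intro n η hηL c₀ c₁ _ _ hdiag m _ U hRS α hα hαle hUb hUε hUa εU hεU hεg hLε hLb hUstar hRlev hpos' M Rr H k
  have hm : ∀ i, 1 ≤ m i := fun i => Nat.one_le_iff_ne_zero.mpr (NeZero.ne (m i))
  -- the big-block projections and the owner's closed gradient row at this background
  obtain ⟨PS, hPS⟩ := exists_block_clm_family (𝕜 := ℂ) (w := fun _ : TSite d (towerP L m (n + 1)) => c₀) (V := W)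
    (π := fun x : TSite d (towerP L m (n + 1)) => blockCoord (L ^ (n + 1)) m (siteCast (towerP_eq_fineP_pow L m (n + 1)) x))
  have hrowU := hrow n η hηL c₀ c₁ hdiag m U hRS α hα hαle hUb hUε hUa εU hεU hεg hLε hLb hUstar hRlev hpos' PS hPS
  -- names for the dictionary
  set Td : Fin d → Equiv.Perm (TSite d (towerP L m (n + 1))) := fun μ => shiftEquiv (Pd := towerP L m (n + 1)) μ with hTd
  set Ud : Fin d → TSite d (towerP L m (n + 1)) → 𝔸ˣ := fun μ y => U (y, μ) with hUd
  set Gp := GpOfUk L m n φ η U a' (c₁ := c₁) hpos' with hGp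
  -- THE 𝔸-ROW OF THE FORWARD LETTER AT A SHIFTED SITE: `‖η⁻¹ D_μ(readA G′ g)(z)‖ ≤ M_φM_φ′B·e^{−κ′d(blkK(z+e_μ), v)}·B_g`
  have hF : ∀ (μ : Fin d) (v : TSite d m) (g : TSite d (towerP L m (n + 1)) → 𝔸) (Bg : ℝ), 0 ≤ Bg →
      (∀ x, blkK L m n x ≠ v → g x = 0) → (∀ x, blkK L m n x = v → ‖g x‖ ≤ Bg) → ∀ z,
      ‖((η : ℂ))⁻¹ • covD Td Ud μ (readA φ Gp g) z‖ ≤ Mφ * Mφ' * B * Real.exp (-(κ' * tdist m (blkK L m n (shift μ z)) v)) * Bg := by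
    intro μ v g Bg hBg hoff hbd z
    set f : SiteL2K ℂ d (towerP L m (n + 1)) c₀ W :=
      (WL2.equiv ℂ (fun _ : TSite d (towerP L m (n + 1)) => c₀) W).symm fun y => φ.symm (g y) with hf
    have hfoff : ∀ x, blockCoord (L ^ (n + 1)) m (siteCast (towerP_eq_fineP_pow L m (n + 1)) x) ≠ v →
        WL2.equiv ℂ (fun _ : TSite d (towerP L m (n + 1)) => c₀) W f x = 0 := fun x hx => by
      rw [hf, Equiv.apply_symm_apply, hoff x (by rwa [blkK_eq_blockCoord_siteCast]), map_zero]
    have hfbd : ∀ y, ‖WL2.equiv ℂ (fun _ : TSite d (towerP L m (n + 1)) => c₀) W f y‖ ≤ Mφ' * Bg := fun y => by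
      rw [hf, Equiv.apply_symm_apply]
      by_cases hy : blkK L m n y = v
      · exact (hφn' _).trans (mul_le_mul_of_nonneg_left (hbd y hy) hMφ')
      · rw [hoff y hy, map_zero, norm_zero]; positivity
    have hD := hrowU v f (Mφ' * Bg) (mul_nonneg hMφ' hBg) hfoff hfbd (z, μ)
    rw [← blkK_eq_blockCoord_siteCast] at hD
    have hread : readA φ Gp g = fun y => φ (WL2.equiv ℂ (fun _ : TSite d (towerP L m (n + 1)) => c₀) W (Gp f) y) := by
      funext y; rw [readA_apply]
    rw [hread, hTd, hUd, ← phi_covDerivL2K]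
    calc ‖φ (WL2.equiv ℂ (fun _ : Bond d (towerP L m (n + 1)) => c₀) W (covDerivL2K ℂ c₀ ((η : ℂ))⁻¹ (adTransportW φ U) (Gp f)) (z, μ))‖
        ≤ Mφ * ‖WL2.equiv ℂ (fun _ : Bond d (towerP L m (n + 1)) => c₀) W (covDerivL2K ℂ c₀ ((η : ℂ))⁻¹ (adTransportW φ U) (Gp f)) (z, μ)‖ := hφn _
      _ ≤ Mφ * (B * (Mφ' * Bg) * Real.exp (-(κ' * tdist m (blkK L m n (btgt (z, μ))) v))) := mul_le_mul_of_nonneg_left hD hMφ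
      _ = Mφ * Mφ' * B * Real.exp (-(κ' * tdist m (blkK L m n (shift μ z)) v)) * Bg := by ring
  -- the sup-distance of the shifted block to `v` against that of the block: one coarse unit
  have hshift : ∀ (μ : Fin d) (v : TSite d m) (x : TSite d (towerP L m (n + 1))),
      Real.exp (-(κ' * tdist m (blkK L m n (shift μ x)) v)) ≤ Real.exp κ' * Real.exp (-(κ' * tdist m (blkK L m n x) v)) := by
    intro μ v x
    rw [← Real.exp_add]
    refine Real.exp_le_exp.mpr ?_
    have h1 : tdist m (blkK L m n x) v ≤ tdist m (blkK L m n x) (blkK L m n (shift μ x)) + tdist m (blkK L m n (shift μ x)) v :=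
      tdist_triangle hm _ _ _
    have h2 := tdist_blkK_shift_le_one L m n μ x
    nlinarith [hκ'.le, h1, h2]
  -- THE 𝔸-ROW OF `∇_k ∘ readA G′` FOR BOTH KINDS OF LETTER, kernel `M_φM_φ′Be^{κ′}·e^{−κ′d_∞(blkK x, v)}`
  have hRow : ∀ (v : TSite d m) (g : TSite d (towerP L m (n + 1)) → 𝔸) (Bg : ℝ), 0 ≤ Bg →
      (∀ x, blkK L m n x ≠ v → g x = 0) → (∀ x, blkK L m n x = v → ‖g x‖ ≤ Bg) → ∀ x,
      ‖(diffLetter Td Ud ((η : ℂ))⁻¹ k * readA φ Gp) g x‖ ≤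
        (Mφ * Mφ' * B * Real.exp κ' * Real.exp (-(κ' * tdist m (blkK L m n x) v))) * Bg := by
    intro v g Bg hBg hoff hbd x
    have hK0 : 0 ≤ Mφ * Mφ' * B := by positivity
    rcases k with μ | μ
    · -- forward: `η⁻¹D_μ(readA G′ g)(x)`, decay from the block of `x + e_μ`
      rw [diffLetter_inl, hTd, hUd, gradLetterF_mul_readA_apply]
      refine (hF μ v g Bg hBg hoff hbd x).trans ?_
      have := hshift μ v x
      calc Mφ * Mφ' * B * Real.exp (-(κ' * tdist m (blkK L m n (shift μ x)) v)) * Bg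
          ≤ Mφ * Mφ' * B * (Real.exp κ' * Real.exp (-(κ' * tdist m (blkK L m n x) v))) * Bg := by gcongr
        _ = Mφ * Mφ' * B * Real.exp κ' * Real.exp (-(κ' * tdist m (blkK L m n x) v)) * Bg := by ring
    · -- backward: `−η⁻¹D*_μ(readA G′ g)(x) = R(U_μ(x′))⁻¹·η⁻¹D_μ(readA G′ g)(x′)`, `x′ + e_μ = x`
      have hx' : (Td μ).symm x = unshift μ x := rfl
      rw [diffLetter_inr, Module.End.mul_apply, LinearMap.neg_apply, Pi.neg_apply, norm_neg, gradLetterB_apply, covDstar_eq_neg_R_covD,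
        smul_neg, norm_neg, ← R_smul, hx']
      refine (norm_R_le_of_norm_le_one _ ?_ _).trans ?_
      · have hu := hUb (unshift μ x, μ)
        refine ⟨hu.2, ?_⟩
        rw [inv_inv]
        exact hu.1
      · have h := hF μ v g Bg hBg hoff hbd (unshift μ x)
        rw [shift_unshift] at h
        refine h.trans ?_
        have h1 : Real.exp (-(κ' * tdist m (blkK L m n x) v)) ≤ Real.exp κ' * Real.exp (-(κ' * tdist m (blkK L m n x) v)) :=
          le_mul_of_one_le_left (Real.exp_pos _).le (Real.one_le_exp hκ'.le)
        calc Mφ * Mφ' * B * Real.exp (-(κ' * tdist m (blkK L m n x) v)) * Bg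
            ≤ Mφ * Mφ' * B * (Real.exp κ' * Real.exp (-(κ' * tdist m (blkK L m n x) v))) * Bg := by gcongr
          _ = Mφ * Mφ' * B * Real.exp κ' * Real.exp (-(κ' * tdist m (blkK L m n x) v)) * Bg := by ring
  -- the seam and the shape of `thm34_Gp_uniform`
  have hmaj := hasMajorant_conj_of_blockRow b (G := toB6 (towerGeom L m n η M) Rr H) (blkK L m n) hM₂ hrepr
    (diffLetter Td Ud ((η : ℂ))⁻¹ k * readA φ Gp) (fun a a'' => Mφ * Mφ' * B * Real.exp κ' * Real.exp (-(κ' * tdist m a a''))) hRow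
  rw [B9Eq352DivFormLetters.conj_mul] at hmaj
  refine hasMajorant_mono _ hmaj fun a a'' => ?_
  have hlen : (towerGeom L m n η M).len a = 1 := by rw [len_towerGeom, mul_comm]; exact hηL
  have hexp : Real.exp (-(κ' * tdist m a a'')) ≤ Real.exp (-(κ' / d * (towerGeom L m n η M).dist a a'')) := by
    refine Real.exp_le_exp.mpr (neg_le_neg ?_)
    rw [dist_towerGeom]
    have h1 := tdist1_le_card_mul_tdist m a a''
    calc κ' / d * B9Thm37GlueTorus.tdist1 m a a'' ≤ κ' / d * (d * tdist m a a'') := mul_le_mul_of_nonneg_left h1 (div_pos hκ' hd0).le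
      _ = κ' * tdist m a a'' := by field_simp
  rw [hlen, mul_one]
  calc M₂ * (∑ i, ‖b i‖) * (Mφ * Mφ' * B * Real.exp κ' * Real.exp (-(κ' * tdist m a a'')))
      = (M₂ * (∑ i, ‖b i‖) * (Mφ * Mφ' * B * Real.exp κ')) * Real.exp (-(κ' * tdist m a a'')) := by ring
    _ ≤ (M₂ * (∑ i, ‖b i‖) * (Mφ * Mφ' * B * Real.exp κ') + 1) * Real.exp (-(κ' / d * (towerGeom L m n η M).dist a a'')) :=
        mul_le_mul (by linarith) hexp (Real.exp_pos _).le (by positivity)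

end Main

end Literature.MathematicalPhysics.QuantumFieldTheory.Balaban1983to89.B9Eq342TowerGradientRowMajorant

end
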